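import Summits.QuantumFields.YangMills.Theorems.UnitScaleTiltProp7SymAvgJointAnalytic
import Summits.QuantumFields.YangMills.Theorems.UnitScaleTiltProp8ChartLocality
import Summits.QuantumFields.BalabanUV.T4Continuum.Support.NE9RelativeChartPlaquette
import HarnessLib

/-!
# Route `UnitScaleTilt`, crux K1 child «MinimiserStabilityRegPr» (stmt-QuantumFields-19200), stub `stub_existenceMinimalOrbit` (EX), route (α), node (AVG-SYM),
# row (46)∕M12, brick (T2) — **THE COVARIANT DEFECT ROW, `P`-LEVEL AND FIELD-GENERIC: THE LINEARISED SYMMETRIC LOG-CHART AT A BACKGROUND WHICH A GAUGE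
# `û` MAKES `s_B`-FLAT ON THE TWO BLOCKS OF THE COARSE BOND IS, UP TO `(16M₁∕ρ²)·2s_B·‖Y‖`, THE `û`-TRANSPORTED FLAT LINEARISED CHART**
# (★★OWNER RULING M12 2026-08-28T03:46:59Z (T2): «`QSym U₀` vs the ψ-transported flat average»; the flat comparison `‖QSym U₀ − QSym 1‖` is NOT a valid
# row — gauge-dependent — this is the covariant one).

Cell `ym3-torus`, width seat `ym-ust-20520-w4` (gen 2).  YM₃ on T³ is a ladder rung (R3), NOT the Clay problem; nothing here is a claim about the stub, the crux, d = 4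
or the mass gap.  `--supports stmt-QuantumFields-19200 --as helper`; count-neutral; def-free.

THE ARGUMENT (all by name).  Background `V₀ : GaugeField P 0 𝔸ˣ`, gauge `û : T⁽⁰⁾ → 𝔸ˣ` with `‖û‖, ‖û⁻¹‖ ≤ 1`, coarse bond `e` of height `k`; hypothesis: on every
finest bond `b` under the two `k`-blocks of `e`, `‖V₀^{û}(b) − 1‖ ≤ s_B` (`4s_B < ρ`, budget `6400ℓ²Lᵏ(5ρ) ≤ 1`).  (1) GAUGE: the relative iterate
`Ū^{(k)}(e^{A}V₀)(e)·Ū^{(k)}(V₀)(e)⁻¹ = T⁻¹·[Ū^{(k)}((e^{A}V₀)^{û})(e)·Ū^{(k)}(V₀^{û})(e)⁻¹]·T`, `T := û^{(k)}(e₋)` (`emlIterU_mul_inv_eq_conj`, p599877) and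
`(e^{A}V₀)^{û}(b) = e^{Ad_û A(b)}·V₀^{û}(b)` (`exp_units_conj`); (2) LOCALITY: on the two blocks `V₀^{û}(b) = e^{B₀(b)}` with `B₀(b) := log V₀^{û}(b)` there and
`0` elsewhere (`MatrixLog.exp_mlog`), `‖B₀‖ ≤ 2s_B < ρ∕2`, so both iterates at `e` are those of the JOINT field `e^{Ad_û A}e^{B₀}` and of `e^{B₀}`
(`Prop8Chart.emlIterU_congr_of_agree`); (3) `log(T⁻¹XT) = T⁻¹(log X)T` (`ExpMeanLog.mlog_conj`) ⇒ the chart at `V₀` is `conj_T ∘ slice_{B₀} ∘ Ad_û`, all three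
pieces differentiable (`differentiableAt_slice_zero`), chain rule; (4) ★★`norm_fderiv_slice_sub_fderiv_flat_le` (p603857-chain file `…SymAvgJointAnalytic`) bounds
`slice_{B₀}′(0) − flat′(0)` by `(16M₁∕ρ²)‖B₀‖`, and `conj_T`, `Ad_û` do not increase norms.

WHAT THIS FILE PROVES (sorry-free, no definition).
* §1 letters: `transfUp_eq_apply` (`û^{(k)}(z) = û(·)`), the sup bound of the conjugation `Ad_û Y` (`NE9RelativeChartPlaquette.norm_conj_le` bondwise); `expUnit_conj` (`û e^{X} û⁻¹ = e^{ûXû⁻¹}`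
  as units); `gaugeActT_perturbed` (`(e^{A}V₀)^{û}(b) = e^{Ad_û A(b)}·V₀^{û}(b)`).
* §2 ★★★ **`norm_fderiv_logRel_sub_conj_flat_le`** — under the hypotheses above, for every `Y`:
  `‖∂_A|₀ log[Ū^{(k)}(e^{A}V₀)(e)·Ū^{(k)}(V₀)(e)⁻¹]·Y − T⁻¹·(∂_A|₀ log[Ū^{(k)}(e^{A})(e)]·(Ad_û Y))·T‖ ≤ (16M₁∕ρ²)·(2s_B)·‖Y‖`, `M₁ = 240ℓLᵏ(5ρ)`,
  and `differentiableAt_logRel_zero` (the chart at `V₀` is differentiable at `0`, so `QSym`'s `fderiv` is an honest derivative there).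
HONEST SCOPE.  Bookkeeping; the estimate is File A's Schwarz bound.  The T³ reading (`QSym F n K h U₀` vs `QSym F n K h 1`, `RegPr`, the block-centre axial gauges
`σ_c := axialT U₀ (toFine (K−n) c₋)` of (T1) ★w4-19200 g2 with `s_B = 3ε₀L^{−(K−n)}`, `ρ = L^{−(K−n)}∕(10⁶L²)`, hence a k-FREE `δ₀ = c·L³ε₀` in front of `L^{K−n}‖Y‖`)
is the companion `…Prop7QSymCovDefectT3`.

References: T. Bałaban, CMP **102** (1985) 277–309 [Balaban1985Variational] ((44)–(46) p.285); CMP **98** (1985) 17–51 [Balaban1985Averaging] ((8)–(12) p.19,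
Prop. 4 (134)–(135) p.38, Prop. 5 (157) p.42); CMP **109** (1987) 249–301 [Balaban1987RG1] ((0.4) p.253, (0.21) p.256).
-/

noncomputable section

open scoped BigOperators
open NormedSpace Metric Set

namespace Summit.QuantumFields.YangMills.Theorems.Prop7SymAvgRelativeBound

open Literature.MathematicalPhysics.QuantumFieldTheory.Balaban1983to89
open T4Continuum BlockAveraging AveragingRT
open B5Eq118OneStroke (iterBlockOf)
open B7Prop1Explicit (expUnit val_expUnit)
open B10Eq27TorusAxialLog (gaugeActT gaugeActT_apply)
open MatrixLog (mlog mlog_one exp_mlog norm_mlog_le_two_mul)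
open Summit.QuantumFields.YangMills.Theorems.Prop8Chart (emlIterU emlIterU_zero emlIterU_succ emlIterU_one emlIterU_congr_of_agree)
open Summit.QuantumFields.BalabanUV.T4Continuum (NE9RelativeChartPlaquette.norm_conj_le)

variable {P : Params}

section Generic

variable {𝔸 : Type*} [NormedRing 𝔸] [NormedAlgebra ℂ 𝔸] [CompleteSpace 𝔸] [NormOneClass 𝔸]

/-! ## §1 Letters: the lifted gauge, conjugations, the gauged perturbed field -/

omit [NormedRing 𝔸] [NormedAlgebra ℂ 𝔸] [CompleteSpace 𝔸] [NormOneClass 𝔸] in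
/-- `û^{(k)}(z)` is a value of `û` (at the base point of the `k`-block `z`). [cite: Balaban1985Averaging, (8) p.19] -/
theorem transfUp_eq_apply {G : Type*} (û : GaugeTransf P 0 G) : ∀ (k : ℕ) (z : Site P k), ∃ x : Site P 0, transfUp û k z = û x
  | 0, z => ⟨z, rfl⟩
  | k + 1, z => transfUp_eq_apply û k (emb z)

omit [NormedAlgebra ℂ 𝔸] [CompleteSpace 𝔸] [NormOneClass 𝔸] in
/-- The bondwise conjugation `Ad_û Y (b) = û(b₋)Y(b)û(b₋)⁻¹` does not increase the sup norm. [folklore] -/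
theorem norm_adField_le (û : GaugeTransf P 0 𝔸ˣ) (hû : ∀ x, ‖((û x : 𝔸ˣ) : 𝔸)‖ ≤ 1) (hû' : ∀ x, ‖(((û x)⁻¹ : 𝔸ˣ) : 𝔸)‖ ≤ 1)
    (Y : PBond P 0 → 𝔸) : ‖(fun b : PBond P 0 => ((û b.src : 𝔸ˣ) : 𝔸) * Y b * (((û b.src)⁻¹ : 𝔸ˣ) : 𝔸))‖ ≤ ‖Y‖ := by
  refine (pi_norm_le_iff_of_nonneg (norm_nonneg Y)).2 fun b => ?_
  exact (NE9RelativeChartPlaquette.norm_conj_le (hû b.src) (hû' b.src)).trans (norm_le_pi_norm Y b)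

omit [NormOneClass 𝔸] in
/-- **`û·e^{X}·û⁻¹ = e^{ûXû⁻¹}` AS UNITS** (`NormedSpace.exp_units_conj`). [folklore] -/
theorem expUnit_conj (u : 𝔸ˣ) (X : 𝔸) : u * expUnit X * u⁻¹ = expUnit ((u : 𝔸) * X * ((u⁻¹ : 𝔸ˣ) : 𝔸)) := by
  letI : NormedAlgebra ℚ 𝔸 := NormedAlgebra.restrictScalars ℚ ℂ 𝔸
  apply Units.ext
  simp only [Units.val_mul, val_expUnit]
  exact (exp_units_conj u X).symm

omit [NormOneClass 𝔸] in
/-- **THE GAUGED PERTURBED FIELD**: `(e^{A}V₀)^{û}(b) = e^{Ad_û A(b)}·V₀^{û}(b)`. [cite: Balaban1985Averaging, (8) p.19] -/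
theorem gaugeActT_perturbed (û : GaugeTransf P 0 𝔸ˣ) (V₀ : GaugeField P 0 𝔸ˣ) (A : PBond P 0 → 𝔸) (b : PBond P 0) :
    gaugeActT û (fun b => expUnit (A b) * V₀ b) b =
      expUnit (((û b.src : 𝔸ˣ) : 𝔸) * A b * (((û b.src)⁻¹ : 𝔸ˣ) : 𝔸)) * gaugeActT û V₀ b := by
  rw [gaugeActT_apply, gaugeActT_apply, ← expUnit_conj]
  group

/-! ## §2 ★★★ The covariant defect row -/

/-- ★★★ **THE COVARIANT DEFECT ROW.**  Background `V₀`, a norm-`≤ 1` gauge `û` making `V₀` `s_B`-flat on the two `k`-blocks of `e` (`0 ≤ s_B`, `4s_B < ρ`),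
budget `6400ℓ²Lᵏ(5ρ) ≤ 1`.  Then the chart `A ↦ log[Ū^{(k)}(e^{A}V₀)(e)·Ū^{(k)}(V₀)(e)⁻¹]` is differentiable at `0`, and for every `Y`
`‖∂_A|₀ chart·Y − T⁻¹·(∂_A|₀ log Ū^{(k)}(e^{A})(e)·(Ad_û Y))·T‖ ≤ (16M₁∕ρ²)·(2s_B)·‖Y‖`, `T := û^{(k)}(e₋)`, `M₁ = 240ℓLᵏ(5ρ)`.
[cite: Balaban1985Variational, (44)-(46) p.285; Balaban1985Averaging, (8)-(12) p.19, Prop. 4 (134)-(135) p.38, Prop. 5 (157) p.42; Balaban1987RG1, (0.4) p.253] -/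
theorem differentiableAt_logRel_zero {k : ℕ} (hk : k ≤ P.m + P.K) (e : PBond P k) (V₀ : GaugeField P 0 𝔸ˣ) (û : GaugeTransf P 0 𝔸ˣ)
    (hû : ∀ x, ‖((û x : 𝔸ˣ) : 𝔸)‖ ≤ 1) (hû' : ∀ x, ‖(((û x)⁻¹ : 𝔸ˣ) : 𝔸)‖ ≤ 1) {sB ρ : ℝ} (hρ0 : 0 < ρ)
    (hbudget : 6400 * (((P.d + 2) * P.L : ℕ) : ℝ) ^ 2 * (P.L : ℝ) ^ k * (5 * ρ) ≤ 1) (hsB0 : 0 ≤ sB) (hsB : 4 * sB < ρ)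
    (hV : ∀ b : PBond P 0, (iterBlockOf k b.src = e.src ∨ iterBlockOf k b.src = e.tgt) → (iterBlockOf k b.tgt = e.src ∨ iterBlockOf k b.tgt = e.tgt) →
      ‖((gaugeActT û V₀ b : 𝔸ˣ) : 𝔸) - 1‖ ≤ sB) :
    DifferentiableAt ℂ (fun A : PBond P 0 → 𝔸 =>
      mlog (((emlIterU k (fun b => expUnit (A b) * V₀ b) e : 𝔸ˣ) : 𝔸) * (((emlIterU k V₀ e)⁻¹ : 𝔸ˣ) : 𝔸))) 0 ∧
    ∀ Y : PBond P 0 → 𝔸,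
      ‖fderiv ℂ (fun A : PBond P 0 → 𝔸 =>
            mlog (((emlIterU k (fun b => expUnit (A b) * V₀ b) e : 𝔸ˣ) : 𝔸) * (((emlIterU k V₀ e)⁻¹ : 𝔸ˣ) : 𝔸))) 0 Y -
          (((transfUp û k e.src)⁻¹ : 𝔸ˣ) : 𝔸) *
            fderiv ℂ (fun A : PBond P 0 → 𝔸 => mlog ((emlIterU k (fun b => expUnit (A b)) e : 𝔸ˣ) : 𝔸)) 0
              (fun b : PBond P 0 => ((û b.src : 𝔸ˣ) : 𝔸) * Y b * (((û b.src)⁻¹ : 𝔸ˣ) : 𝔸)) *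
            ((transfUp û k e.src : 𝔸ˣ) : 𝔸)‖ ≤
        16 * (240 * (((P.d + 2) * P.L : ℕ) : ℝ) * (P.L : ℝ) ^ k * (5 * ρ)) / ρ ^ 2 * (2 * sB) * ‖Y‖ := by
  classical
  have hρ4 := rho_le_quarter_of_budget hρ0.le hbudget
  -- letters
  set T : 𝔸ˣ := transfUp û k e.src with hT
  obtain ⟨xT, hxT⟩ := transfUp_eq_apply û k e.src
  have hTn : ‖(T : 𝔸)‖ ≤ 1 := by rw [hT, hxT]; exact hû xT
  have hTn' : ‖((T⁻¹ : 𝔸ˣ) : 𝔸)‖ ≤ 1 := by rw [hT, hxT]; exact hû' xT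
  set flat : (PBond P 0 → 𝔸) → 𝔸 := fun X => mlog ((emlIterU k (fun b => expUnit (X b)) e : 𝔸ˣ) : 𝔸) with hflat
  set V : GaugeField P 0 𝔸ˣ := gaugeActT û V₀ with hVdef
  set TB : PBond P 0 → Prop := fun b =>
    (iterBlockOf k b.src = e.src ∨ iterBlockOf k b.src = e.tgt) ∧ (iterBlockOf k b.tgt = e.src ∨ iterBlockOf k b.tgt = e.tgt) with hTB
  set B₀ : PBond P 0 → 𝔸 := fun b => if TB b then mlog ((V b : 𝔸ˣ) : 𝔸) else 0 with hB₀
  -- sizes: `‖B₀‖ ≤ 2 s_B < ρ/2`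
  have hVb : ∀ b, TB b → ‖((V b : 𝔸ˣ) : 𝔸) - 1‖ ≤ sB := fun b hb => hV b hb.1 hb.2
  have hB₀b : ∀ b, ‖B₀ b‖ ≤ 2 * sB := by
    intro b
    by_cases hb : TB b
    · have h1 : ‖((V b : 𝔸ˣ) : 𝔸) - 1‖ ≤ 1 / 2 := (hVb b hb).trans (by linarith)
      simp only [hB₀, hb, if_true]
      exact (norm_mlog_le_two_mul h1).trans (by linarith [hVb b hb])
    · simp only [hB₀, hb, if_false, norm_zero]; positivity
  have hB₀n : ‖B₀‖ ≤ 2 * sB := (pi_norm_le_iff_of_nonneg (by positivity)).2 hB₀b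
  have hB₀lt : ‖B₀‖ < ρ / 2 := by linarith
  -- (2) on two-block bonds `V b = e^{B₀ b}`
  have hagree : ∀ b, TB b → expUnit (B₀ b) = V b := by
    intro b hb
    apply Units.ext
    rw [val_expUnit]
    simp only [hB₀, hb, if_true]
    exact exp_mlog ((hVb b hb).trans_lt (by linarith))
  -- the conjugations as continuous linear maps
  set AdL : (PBond P 0 → 𝔸) →L[ℂ] (PBond P 0 → 𝔸) :=
    ContinuousLinearMap.pi fun b : PBond P 0 =>
      ((ContinuousLinearMap.mulLeftRight ℂ 𝔸) ((û b.src : 𝔸ˣ) : 𝔸) (((û b.src)⁻¹ : 𝔸ˣ) : 𝔸)).comp (ContinuousLinearMap.proj b) with hAdL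
  have hAdL_apply : ∀ Y : PBond P 0 → 𝔸, AdL Y = fun b => ((û b.src : 𝔸ˣ) : 𝔸) * Y b * (((û b.src)⁻¹ : 𝔸ˣ) : 𝔸) := by
    intro Y; funext b
    simp [hAdL, ContinuousLinearMap.mulLeftRight_apply]
  set conjL : 𝔸 →L[ℂ] 𝔸 := (ContinuousLinearMap.mulLeftRight ℂ 𝔸) ((T⁻¹ : 𝔸ˣ) : 𝔸) (T : 𝔸) with hconjL
  have hconjL_apply : ∀ Z, conjL Z = ((T⁻¹ : 𝔸ˣ) : 𝔸) * Z * (T : 𝔸) := fun Z => by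
    simp [hconjL, ContinuousLinearMap.mulLeftRight_apply]
  -- the slice of the joint chart at `B₀`
  set slice : (PBond P 0 → 𝔸) → 𝔸 := fun X =>
    mlog (((emlIterU k (fun b => expUnit (X b) * expUnit (B₀ b)) e : 𝔸ˣ) : 𝔸) *
      (((emlIterU k (fun b => expUnit (B₀ b)) e)⁻¹ : 𝔸ˣ) : 𝔸)) with hslice
  -- (1)+(2)+(3): the chart at `V₀` is `conjL ∘ slice ∘ AdL`
  have hiter1 : ∀ A : PBond P 0 → 𝔸, emlIterU k (gaugeActT û (fun b => expUnit (A b) * V₀ b)) e =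
      emlIterU k (fun b => expUnit ((AdL A) b) * expUnit (B₀ b)) e := by
    intro A
    refine emlIterU_congr_of_agree k hk e fun b hbs hbt => ?_
    rw [gaugeActT_perturbed, hagree b ⟨hbs, hbt⟩, hAdL_apply]
  have hiter2 : emlIterU k V e = emlIterU k (fun b => expUnit (B₀ b)) e := by
    refine emlIterU_congr_of_agree k hk e fun b hbs hbt => ?_
    rw [hagree b ⟨hbs, hbt⟩]
  have hfunU : (fun A : PBond P 0 → 𝔸 =>
      mlog (((emlIterU k (fun b => expUnit (A b) * V₀ b) e : 𝔸ˣ) : 𝔸) * (((emlIterU k V₀ e)⁻¹ : 𝔸ˣ) : 𝔸))) = fun A => conjL (slice (AdL A)) := by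
    funext A
    rw [hconjL_apply, emlIterU_mul_inv_eq_conj û (fun b => expUnit (A b) * V₀ b) V₀ k e, ← hT, ← hVdef, hiter1 A, hiter2,
      ExpMeanLog.mlog_conj (Units.inv_mul T) (Units.mul_inv T)]
  -- differentiability: slice at `0 = AdL 0`, then the two compositions
  have hslice_diff : DifferentiableAt ℂ slice 0 := differentiableAt_slice_zero hk e hρ0 hbudget B₀ (by linarith)
  have hAd0 : AdL 0 = 0 := map_zero AdL
  have hslice_at : HasFDerivAt slice (fderiv ℂ slice 0) (AdL 0) := by rw [hAd0]; exact hslice_diff.hasFDerivAt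
  have hcomp1 : HasFDerivAt (fun A : PBond P 0 → 𝔸 => slice (AdL A)) ((fderiv ℂ slice 0).comp AdL) 0 :=
    HasFDerivAt.comp (f := fun A : PBond P 0 → 𝔸 => AdL A) (0 : PBond P 0 → 𝔸) hslice_at AdL.hasFDerivAt
  have hcomp2 : HasFDerivAt (fun A : PBond P 0 → 𝔸 => conjL (slice (AdL A))) (conjL.comp ((fderiv ℂ slice 0).comp AdL)) 0 :=
    HasFDerivAt.comp (f := fun A : PBond P 0 → 𝔸 => slice (AdL A)) (0 : PBond P 0 → 𝔸) conjL.hasFDerivAt hcomp1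
  rw [hfunU]
  refine ⟨hcomp2.differentiableAt, fun Y => ?_⟩
  rw [hcomp2.fderiv]
  -- (4): the Schwarz bound of the joint-analytic file, read on `Ad_û Y`
  have hkey := norm_fderiv_slice_sub_fderiv_flat_le hk e hρ0 hbudget B₀ hB₀lt (AdL Y)
  have hAdY : (fun b : PBond P 0 => ((û b.src : 𝔸ˣ) : 𝔸) * Y b * (((û b.src)⁻¹ : 𝔸ˣ) : 𝔸)) = AdL Y := (hAdL_apply Y).symm
  have hAdYn : ‖AdL Y‖ ≤ ‖Y‖ := by rw [hAdL_apply]; exact norm_adField_le û hû hû' Y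
  rw [hAdY, ContinuousLinearMap.comp_apply, ContinuousLinearMap.comp_apply, hconjL_apply]
  have hdiff_eq : ((T⁻¹ : 𝔸ˣ) : 𝔸) * (fderiv ℂ slice 0) (AdL Y) * (T : 𝔸) - ((T⁻¹ : 𝔸ˣ) : 𝔸) * fderiv ℂ flat 0 (AdL Y) * (T : 𝔸) =
      ((T⁻¹ : 𝔸ˣ) : 𝔸) * ((fderiv ℂ slice 0) (AdL Y) - fderiv ℂ flat 0 (AdL Y)) * (T : 𝔸) := by noncomm_ring
  rw [hdiff_eq]
  have hC0 : 0 ≤ 16 * (240 * (((P.d + 2) * P.L : ℕ) : ℝ) * (P.L : ℝ) ^ k * (5 * ρ)) / ρ ^ 2 := by positivity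
  calc ‖((T⁻¹ : 𝔸ˣ) : 𝔸) * ((fderiv ℂ slice 0) (AdL Y) - fderiv ℂ flat 0 (AdL Y)) * (T : 𝔸)‖
      ≤ ‖(fderiv ℂ slice 0) (AdL Y) - fderiv ℂ flat 0 (AdL Y)‖ := NE9RelativeChartPlaquette.norm_conj_le hTn' hTn
    _ ≤ 16 * (240 * (((P.d + 2) * P.L : ℕ) : ℝ) * (P.L : ℝ) ^ k * (5 * ρ)) / ρ ^ 2 * ‖B₀‖ * ‖AdL Y‖ := hkey
    _ ≤ 16 * (240 * (((P.d + 2) * P.L : ℕ) : ℝ) * (P.L : ℝ) ^ k * (5 * ρ)) / ρ ^ 2 * (2 * sB) * ‖Y‖ := by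
        have h1 : 0 ≤ ‖AdL Y‖ := norm_nonneg _
        have h2 : 0 ≤ ‖B₀‖ := norm_nonneg _
        calc _ ≤ 16 * (240 * (((P.d + 2) * P.L : ℕ) : ℝ) * (P.L : ℝ) ^ k * (5 * ρ)) / ρ ^ 2 * (2 * sB) * ‖AdL Y‖ := by gcongr
          _ ≤ _ := by gcongr

end Generic

end Summit.QuantumFields.YangMills.Theorems.Prop7SymAvgRelativeBound

end
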